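import Literature.Geometry.Riemannian.GradientEstimateIntegration
import Literature.Geometry.Riemannian.SurgicalSolutions
import Literature.Geometry.Riemannian.RicciFlowScalarCurvatureEvolution
import Literature.Geometry.Riemannian.RicciFlowRegularity
import Literature.Geometry.Riemannian.RicciFlowScalarCurvatureHolds
import HarnessLib

/-!
# The set `Ω` where the curvature stays bounded at a singular time (Chen–Zhu 2006, §4, p. 24)
(topic `Geometry/Riemannian`)

First step of the surgery construction in the proof of
`Literature.Geometry.Riemannian.chenZhu_ricciFlowWithSurgery` (B.-L. Chen, X.-P. Zhu,
J. Differential Geom. 74 (2006), arXiv:math/0504478, Thm. 1.1; the construction is §5 over §4).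
Chen–Zhu, §4, p. 24, for a solution on a maximal interval `[0, T)` satisfying the gradient
estimates (4.1) of Thm. 4.1 (equivalently, of the canonical neighbourhood assumption of §5,
p. 26): "Let `Ω` denote the set of all points in `M⁴`, where curvature stays bounded as `t → T`.
The estimates (4.1) imply that `Ω` is open and `R(x,t) → +∞` as `t → T` for each
`x ∈ M⁴ ∖ Ω`." This file defines `Ω` and PROVES these two assertions, together with the
quantitative forms that the sequel (the limit metric `ḡ` on `Ω` via Shi's estimates, Lemma 5.2)
consumes:

* `boundedCurvatureSet g cov T` (`Ω`) — the set of `x` with `t ↦ R(x, t)` bounded above on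
  `[0, T)`; for a Ricci flow on a compact manifold it suffices to bound `R(x, ·)` near `T`
  (`IsRicciFlow.mem_boundedCurvatureSet_of_eventually_le`, by
  `IsRicciFlow.exists_scalarCurvatureWith_le_of_lt`).
* From the two gradient estimates near `T` above a curvature threshold `K₀` — hypotheses
  `(hgrad)`: `|∇R| ≤ η R^{3/2}` and `(htime)`: `|∂R/∂t| ≤ η R²` at every `(x, t)`,
  `t ∈ [t⋆, T)`, with `R(x,t) ≥ K₀` — for a Ricci flow of Riemannian metrics on `[0, T)` on a
  compact manifold (any dimension):
  - `IsRicciFlow.inv_mul_le_scalarCurvature_of_not_mem` — **blow-up rate off `Ω`**: for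
    `x ∉ Ω` and `t ∈ [t⋆, T)` with `T − t ≤ (2 η K₀)⁻¹`, `R(x, t) ≥ (η (T − t))⁻¹`
    (uniformly in `x`); hence `IsRicciFlow.tendsto_scalarCurvature_atTop_of_not_mem` —
    **`R(x, t) → +∞` as `t ↑ T`**, and the dichotomy
    `IsRicciFlow.not_mem_boundedCurvatureSet_iff_tendsto`;
  - `IsRicciFlow.exists_nhds_forall_scalarCurvature_le` — every `x ∈ Ω` has a neighbourhood
    on which `R ≤ K` on all of `[0, T)` for one `K`; hence
    `IsRicciFlow.isOpen_boundedCurvatureSet` — **`Ω` is open** — and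
    `IsRicciFlow.exists_forall_scalarCurvature_le_of_isCompact` (a uniform bound on every
    compact subset of `Ω`, the input of the local derivative estimates).
  The proofs integrate the estimates with the lemmas of `GradientEstimateIntegration.lean`:
  in time, `R⁻¹` is `η`-Lipschitz above the threshold (backward: large values at times close
  to `T` force `R(x,t)⁻¹ ≤ η (T − t)`; forward: `R ≤ 4K` at `t₁` stays `≤ 8K` on `[t₁, T)` if
  `T − t₁ ≤ (16 η K)⁻¹`); in space, `R ≤ 4 max(K₀, R(x, t₁))` on a `g(t₁)`-ball around `x`
  (`le_four_mul_max_of_gradient_estimate`, the threshold-free form of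
  `le_four_mul_of_gradient_estimate`).
* `ChenZhuAPriori.gradient_estimates_near` — a stage of a surgical solution satisfying the a
  priori assumptions (`ChenZhuAPriori 𝔭 g cov T t₀`, `SurgicalSolutions.lean`; `r` positive and
  non-increasing, `t₀ ≥ 0`) satisfies `(hgrad)`, `(htime)` on `[T/2, T)` above
  `K₀ = max (r(t₀ + T)⁻², 2/T)` (the canonical neighbourhood of `(x, t)` contains `x`, and its
  gradient estimates are part of `HasCanonicalNeighbourhood`); whence the printed assertions for
  stages: `ChenZhuAPriori.isOpen_boundedCurvatureSet`,
  `ChenZhuAPriori.tendsto_scalarCurvature_atTop_of_not_mem`,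
  `ChenZhuAPriori.exists_nhds_forall_scalarCurvature_le`.

Everything here is proved; the only definition is the set `Ω`; no named fact is introduced.

## References

* B.-L. Chen, X.-P. Zhu, *Ricci flow with surgery on four-manifolds with positive isotropic
  curvature*, J. Differential Geom. 74 (2006) 177–264 (arXiv:math/0504478): Thm. 4.1 with (4.1)
  (p. 19); §4, p. 24; §5, p. 26 (a priori assumptions), p. 27. [ChenZhu2006]
* G. Perelman, *Ricci flow with surgery on three-manifolds*, arXiv:math/0303109 (2003), §3
  (the set `Ω` at the first singular time). [Perelman2003]
-/

noncomputable section

open Bundle Set Function Filter TopologicalSpace Manifold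
open scoped Manifold ContDiff Topology ENNReal NNReal

namespace Literature.Geometry.Riemannian

open Lorentzian

universe u v w

/-! ### The threshold-free spatial estimate -/

section Space

variable {E : Type*} [NormedAddCommGroup E] [NormedSpace ℝ E] [FiniteDimensional ℝ E]
  {H : Type*} [TopologicalSpace H] {I : ModelWithCorners ℝ E H}
  {M : Type*} [TopologicalSpace M] [ChartedSpace H M] [IsManifold I ∞ M]

/-- **The spatial gradient estimate along a path, without a lower bound at the initial point**:
under `|∇R| ≤ η R^{3/2}` on `{R ≥ K}` (`K > 0`), along a `C¹` path of length `≤ ℓ` one has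
`R(γ b) ≤ (m^{-1/2} − (η/2) ℓ)⁻²` with `m = max K (R(γ a))`, provided `(η/2) ℓ < m^{-1/2}`: if
`R(γ a) ≥ K` this is `le_of_gradient_estimate_path`; otherwise apply it from the last parameter
`s₀` with `R(γ s₀) ≤ K` (where `R(γ s₀) = K` unless `R(γ b) ≤ K`). [cite: ChenZhu2006, §4, p. 24] -/
theorem le_of_gradient_estimate_path_max
    (g : PseudoRiemannianMetric I ∞ E (TangentSpace I : M → Type _)) (hg : g.IsRiemannian)
    {R : M → ℝ} (hR : ContMDiff I 𝓘(ℝ, ℝ) 1 R) {K η : ℝ} (hK : 0 < K) (hη : 0 ≤ η)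
    (hgrad : ∀ z, K ≤ R z → Real.sqrt (g.gradSq R z) ≤ η * (R z * Real.sqrt (R z)))
    {γ : ℝ → M} {a b : ℝ} (hab : a ≤ b) (hγ : ContMDiffOn 𝓘(ℝ, ℝ) I 1 γ (Icc a b))
    {ℓ : ℝ} (hℓ : g.length hg γ a b ≤ ENNReal.ofReal ℓ) (hℓ0 : 0 ≤ ℓ)
    (hsmall : η / 2 * ℓ < (Real.sqrt (max K (R (γ a))))⁻¹) :
    R (γ b) ≤ ((Real.sqrt (max K (R (γ a))))⁻¹ - η / 2 * ℓ)⁻¹ ^ 2 := by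
  rcases le_or_gt K (R (γ a)) with hKa | hKa
  · rw [max_eq_right hKa] at hsmall ⊢
    exact le_of_gradient_estimate_path g hg hR hK hη hgrad hab hγ hKa hℓ hℓ0 hsmall
  rw [max_eq_left hKa.le] at hsmall ⊢
  have hsK : 0 < Real.sqrt K := Real.sqrt_pos.2 hK
  have hc : 0 < (Real.sqrt K)⁻¹ - η / 2 * ℓ := sub_pos.2 hsmall
  have hηℓ : 0 ≤ η / 2 * ℓ := by positivity
  -- the trivial case `R (γ b) ≤ K`
  by_cases hb : R (γ b) ≤ K
  · refine hb.trans ?_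
    have h2 : ((Real.sqrt K)⁻¹)⁻¹ ≤ ((Real.sqrt K)⁻¹ - η / 2 * ℓ)⁻¹ := inv_anti₀ hc (by linarith)
    have h3 := pow_le_pow_left₀ (inv_nonneg.2 (inv_nonneg.2 hsK.le)) h2 2
    rwa [inv_inv, Real.sq_sqrt hK.le] at h3
  push Not at hb
  have hφ : ContinuousOn (R ∘ γ) (Icc a b) := hR.continuous.comp_continuousOn hγ.continuousOn
  obtain ⟨s₀, hs₀, hs₀K, hlt⟩ := exists_last_exit hφ ⟨a, left_mem_Icc.2 hab, hKa.le⟩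
  have hs₀K' : R (γ s₀) ≤ K := hs₀K
  have hs₀b : s₀ < b := lt_of_le_of_ne hs₀.2 (by rintro rfl; exact absurd hs₀K' hb.not_ge)
  have hKs₀ : K ≤ R (γ s₀) := le_of_forall_Ioc_le hφ hs₀ hs₀b fun s hs ↦ (hlt s hs).le
  -- apply the thresholded lemma from `s₀`
  have hγ' : ContMDiffOn 𝓘(ℝ, ℝ) I 1 γ (Icc s₀ b) := hγ.mono (Icc_subset_Icc_left hs₀.1)
  have hℓ' : g.length hg γ s₀ b ≤ ENNReal.ofReal ℓ := (length_mono g hg γ hs₀.1 le_rfl).trans hℓ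
  have hRs₀ : R (γ s₀) = K := le_antisymm hs₀K' hKs₀
  have hsmall' : η / 2 * ℓ < (Real.sqrt (R (γ s₀)))⁻¹ := by rwa [hRs₀]
  have h := le_of_gradient_estimate_path g hg hR hK hη hgrad hs₀b.le hγ' hKs₀ hℓ' hℓ0 hsmall'
  rwa [hRs₀] at h

/-- **`R ≤ 4 max(K, R(x))` on the ball `B_g(x, 1/(η max(K, R(x))^{1/2}))`** — the threshold-free
form of `le_four_mul_of_gradient_estimate` (gradient estimate `|∇R| ≤ η R^{3/2}` on `{R ≥ K}`,
`K, η > 0`, no assumption on `R(x)`). [cite: ChenZhu2006, §4, p. 24] -/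
theorem le_four_mul_max_of_gradient_estimate
    (g : PseudoRiemannianMetric I ∞ E (TangentSpace I : M → Type _)) (hg : g.IsRiemannian)
    {R : M → ℝ} (hR : ContMDiff I 𝓘(ℝ, ℝ) 1 R) {K η : ℝ} (hK : 0 < K) (hη : 0 < η)
    (hgrad : ∀ z, K ≤ R z → Real.sqrt (g.gradSq R z) ≤ η * (R z * Real.sqrt (R z)))
    {x y : M} (hy : y ∈ g.ball x (ENNReal.ofReal (η * Real.sqrt (max K (R x)))⁻¹)) :
    R y ≤ 4 * max K (R x) := by
  set m : ℝ := max K (R x) with hm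
  have hm0 : 0 < m := hK.trans_le (le_max_left _ _)
  have hsm : 0 < Real.sqrt m := Real.sqrt_pos.2 hm0
  have hη0 : η ≠ 0 := hη.ne'
  have hsm0 : Real.sqrt m ≠ 0 := hsm.ne'
  have hd0 : 0 ≤ (η * Real.sqrt m)⁻¹ := by positivity
  have hkey : (Real.sqrt m)⁻¹ - η / 2 * (η * Real.sqrt m)⁻¹ = (Real.sqrt m)⁻¹ / 2 := by
    rw [mul_inv, ← mul_assoc, div_mul_eq_mul_div, mul_inv_cancel₀ hη0, one_div]
    ring
  have hsmall : η / 2 * (η * Real.sqrt m)⁻¹ < (Real.sqrt m)⁻¹ := by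
    have : 0 < (Real.sqrt m)⁻¹ := inv_pos.2 hsm
    linarith [hkey]
  -- a path of length `< (η √m)⁻¹` from `x` to `y`
  letI := g.riemannianBundle hg
  rw [PseudoRiemannianMetric.mem_ball, PseudoRiemannianMetric.riemEDist_eq hg] at hy
  have hxy' : riemannianEDist I x y < ENNReal.ofReal (η * Real.sqrt m)⁻¹ := hy
  obtain ⟨γ, hγx, hγy, hγs, hγl⟩ := exists_lt_of_riemannianEDist_lt hxy'
  have hγl' : g.length hg γ 0 1 ≤ ENNReal.ofReal (η * Real.sqrt m)⁻¹ := hγl.le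
  subst hγx hγy
  have h := le_of_gradient_estimate_path_max g hg hR hK hη.le hgrad zero_le_one hγs hγl' hd0
    hsmall
  rw [hkey] at h
  have h2 : ((Real.sqrt m)⁻¹ / 2)⁻¹ = 2 * Real.sqrt m := by
    rw [inv_div, div_inv_eq_mul]
  calc R (γ 1) ≤ ((Real.sqrt m)⁻¹ / 2)⁻¹ ^ 2 := h
    _ = 4 * m := by
        rw [h2, mul_pow, Real.sq_sqrt hm0.le]
        norm_num

end Space

/-! ### `Ω`: the set where the scalar curvature stays bounded -/

section Omega

variable {E : Type u} [NormedAddCommGroup E] [NormedSpace ℝ E] [FiniteDimensional ℝ E]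
  {H : Type v} [TopologicalSpace H] {I : ModelWithCorners ℝ E H}
  {M : Type w} [TopologicalSpace M] [ChartedSpace H M] [IsManifold I ∞ M]

/-- **`Ω`, the set where the curvature stays bounded as `t → T`** (Chen–Zhu 2006, §4, p. 24:
"Let `Ω` denote the set of all points in `M⁴`, where curvature stays bounded as `t → T`";
Perelman 2003, §3), for a family `(g, cov)` of metrics with connections on `[0, T)`: the set of
`x` for which `t ↦ R(x, t) = scalarCurvatureWith (g t) (cov t) x` is bounded above on `[0, T)`.
(For the pinched solutions of Chen–Zhu all curvatures are controlled by `R`; and for a Ricci flow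
on a compact manifold only times near `T` matter, `mem_boundedCurvatureSet_of_eventually_le`.)
[cite: ChenZhu2006, §4, p. 24] -/
def boundedCurvatureSet (g : ℝ → PseudoRiemannianMetric I ∞ E (TangentSpace I : M → Type _))
    (cov : ℝ → CovariantDerivative I E (TangentSpace I : M → Type _)) (T : ℝ) : Set M :=
  {x | ∃ K : ℝ, ∀ t ∈ Ico 0 T, (g t).scalarCurvatureWith (cov t) x ≤ K}

variable {g : ℝ → PseudoRiemannianMetric I ∞ E (TangentSpace I : M → Type _)}
  {cov : ℝ → CovariantDerivative I E (TangentSpace I : M → Type _)} {T : ℝ}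

/-- Membership in `Ω`: `t ↦ R(x, t)` is bounded above on `[0, T)`. [cite: ChenZhu2006, §4, p. 24] -/
theorem mem_boundedCurvatureSet_iff {x : M} :
    x ∈ boundedCurvatureSet g cov T ↔
      ∃ K : ℝ, ∀ t ∈ Ico 0 T, (g t).scalarCurvatureWith (cov t) x ≤ K := Iff.rfl

variable [CompleteSpace E] [I.Boundaryless]

/-- **Only times near `T` matter**: for a Ricci flow on `[0, T)` on a compact manifold without
boundary, if `R(x, ·) ≤ K` on `[t₁, T)` for some `t₁ < T` then `x ∈ Ω` (on `[0, t₁]` the scalar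
curvature of the whole solution is bounded, `IsRicciFlow.exists_scalarCurvatureWith_le_of_lt`).
[cite: ChenZhu2006, §4, p. 24] -/
theorem IsRicciFlow.mem_boundedCurvatureSet_of_eventually_le [CompactSpace M]
    (hflow : IsRicciFlow g cov (Ico 0 T)) {x : M} {t₁ K : ℝ} (ht₁ : t₁ < T)
    (hK : ∀ t ∈ Ico t₁ T, (g t).scalarCurvatureWith (cov t) x ≤ K) :
    x ∈ boundedCurvatureSet g cov T := by
  obtain ⟨K₀, hK₀⟩ := hflow.exists_scalarCurvatureWith_le_of_lt ht₁
  refine ⟨max K₀ K, fun t ht ↦ ?_⟩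
  rcases le_or_gt t t₁ with h | h
  · exact (hK₀ t ⟨ht.1, h⟩ x).trans (le_max_left _ _)
  · exact (hK t ⟨h.le, ht.2⟩).trans (le_max_right _ _)

/-! ### The time derivative of `R(x, ·)` within `[0, T)` -/

/-- Along a Ricci flow on `[0, T)`, at every `t ∈ [0, T)` the function `s ↦ R(x, s)` is
differentiable within `[0, T)`, with derivative `derivWithin (R(x, ·)) [0, T) t`
(`= Δ R + 2|Ric|²`, Topping 2006, Prop. 2.5.4, `IsRicciFlow.hasDerivWithinAt_scalarCurvatureWith`
on `[0, b]`, `t < b < T`). [cite: Topping2006, Prop. 2.5.4] -/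
theorem IsRicciFlow.hasDerivWithinAt_scalarCurvatureWith_Ico
    (hflow : IsRicciFlow g cov (Ico 0 T)) {t : ℝ} (ht : t ∈ Ico 0 T) (x : M) :
    HasDerivWithinAt (fun s ↦ (g s).scalarCurvatureWith (cov s) x)
      (derivWithin (fun s ↦ (g s).scalarCurvatureWith (cov s) x) (Ico 0 T) t) (Ico 0 T) t := by
  set b : ℝ := (t + T) / 2 with hb
  have htb : t < b := by rw [hb]; linarith [ht.2]
  have hbT : b < T := by rw [hb]; linarith [ht.2]
  have hb0 : 0 < b := ht.1.trans_lt htb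
  have hflow' : IsRicciFlow g cov (Icc 0 b) := hflow.mono (Icc_subset_Ico_right hbT)
  have hd := hflow'.hasDerivWithinAt_scalarCurvatureWith hb0 ⟨ht.1, htb.le⟩ x
  have hmem : Icc 0 b ∈ 𝓝[Ico 0 T] t :=
    mem_nhdsWithin.2 ⟨Iio b, isOpen_Iio, htb, fun s hs ↦ ⟨hs.2.1, le_of_lt hs.1⟩⟩
  have hd' := hd.mono_of_mem_nhdsWithin hmem
  exact hd'.differentiableWithinAt.hasDerivWithinAt

/-! ### Consequences of the gradient estimates near `T` -/

section Estimates

variable [CompactSpace M]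

/-- **Blow-up rate off `Ω`** (Chen–Zhu 2006, §4, p. 24: "`R(x,t) → +∞` as `t → T` for each
`x ∈ M ∖ Ω`", quantitative form). Let `(g, cov)` be a Ricci flow on `[0, T)`, `T > 0`, on a
compact manifold, satisfying the time gradient estimate `|∂R/∂t| ≤ η R²` (`η > 0`) at every
`(x, t)`, `t ∈ [t⋆, T)`, with `R(x, t) ≥ K₀` (`K₀ > 0`). If `x ∉ Ω` then at every `t ∈ [t⋆, T)`
with `T − t ≤ (2 η K₀)⁻¹`: `R(x, t) > K₀` and `R(x, t) ≥ (η (T − t))⁻¹`. *Proof.* `R(x, ·)` is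
bounded on `[0, t]` but unbounded on `[0, T)`, so for every `ε > 0` there is `s ∈ (t, T)` with
`R(x, s) ≥ max(2K₀, ε⁻¹)`; backward from `s` (`lt_and_inv_le_of_deriv_le_sq`, the threshold
condition being `R(x,s)⁻¹ + η (s − t) < K₀⁻¹`) `R(x, t)⁻¹ ≤ ε + η (s − t) ≤ ε + η (T − t)`.
[cite: ChenZhu2006, §4, p. 24] [cite: ChenZhu2006, Thm. 4.1, (4.1) (p. 19)] -/
theorem IsRicciFlow.inv_mul_le_scalarCurvature_of_not_mem (hflow : IsRicciFlow g cov (Ico 0 T))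
    {η K₀ tstar : ℝ} (hη : 0 < η) (hK₀ : 0 < K₀) (htstar : tstar ∈ Ico 0 T)
    (htime : ∀ t ∈ Ico tstar T, ∀ x : M, K₀ ≤ (g t).scalarCurvatureWith (cov t) x →
      |derivWithin (fun s ↦ (g s).scalarCurvatureWith (cov s) x) (Ico 0 T) t| ≤
        η * (g t).scalarCurvatureWith (cov t) x ^ 2)
    {x : M} (hx : x ∉ boundedCurvatureSet g cov T) {t : ℝ} (ht : t ∈ Ico tstar T)
    (hclose : T - t ≤ (2 * η * K₀)⁻¹) :
    K₀ < (g t).scalarCurvatureWith (cov t) x ∧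
      (η * (T - t))⁻¹ ≤ (g t).scalarCurvatureWith (cov t) x := by
  set φ : ℝ → ℝ := fun s ↦ (g s).scalarCurvatureWith (cov s) x with hφdef
  have ht0 : t ∈ Ico 0 T := ⟨htstar.1.trans ht.1, ht.2⟩
  -- `φ` is bounded on `[0, t]`, unbounded on `[0, T)`
  obtain ⟨B₀, hB₀⟩ := hflow.exists_scalarCurvatureWith_le_of_lt ht.2
  have hunb : ∀ B : ℝ, ∃ s ∈ Ioo t T, B < φ s := by
    intro B
    by_contra hcon
    push Not at hcon
    refine hx ⟨max B₀ B, fun s hs ↦ ?_⟩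
    rcases le_or_gt s t with h | h
    · exact (hB₀ s ⟨hs.1, h⟩ x).trans (le_max_left _ _)
    · exact (hcon s ⟨h, hs.2⟩).trans (le_max_right _ _)
  -- continuity and derivative of `φ`
  have hcont : ContinuousOn φ (Ico 0 T) := hflow.continuousOn_scalarCurvatureWith (uniqueDiffOn_Ico 0 T) x
  have hder : ∀ s ∈ Ico 0 T, HasDerivWithinAt φ (derivWithin φ (Ico 0 T) s) (Ico 0 T) s :=
    fun s hs ↦ hflow.hasDerivWithinAt_scalarCurvatureWith_Ico hs x
  -- the backward estimate from a time `s ∈ (t, T)` with `φ s` large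
  have key : ∀ ε : ℝ, 0 < ε → K₀ < φ t ∧ (φ t)⁻¹ ≤ ε + η * (T - t) := by
    intro ε hε
    obtain ⟨s, hs, hBs⟩ := hunb (max (2 * K₀) ε⁻¹)
    have hsT : Icc t s ⊆ Ico 0 T := fun u hu ↦ ⟨ht0.1.trans hu.1, hu.2.trans_lt hs.2⟩
    have hφs : 0 < φ s := by
      have : 2 * K₀ ≤ max (2 * K₀) ε⁻¹ := le_max_left _ _
      linarith
    have hφs1 : (φ s)⁻¹ ≤ (2 * K₀)⁻¹ :=
      inv_anti₀ (by positivity) ((le_max_left _ _).trans hBs.le)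
    have hφs2 : (φ s)⁻¹ ≤ ε := by
      have h := inv_anti₀ (inv_pos.2 hε) ((le_max_right _ _).trans hBs.le)
      rwa [inv_inv] at h
    have hst : η * (s - t) < (2 * K₀)⁻¹ := by
      have h1 : s - t < T - t := by linarith [hs.2]
      have h2 : η * (s - t) < η * (T - t) := by gcongr
      have h3 : η * (T - t) ≤ η * (2 * η * K₀)⁻¹ := by gcongr
      have h4 : η * (2 * η * K₀)⁻¹ = (2 * K₀)⁻¹ := by
        rw [show 2 * η * K₀ = η * (2 * K₀) by ring, mul_inv, ← mul_assoc,
          mul_inv_cancel₀ hη.ne', one_mul]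
      linarith
    have hsmall : (φ s)⁻¹ + η * (s - t) < K₀⁻¹ := by
      have : (2 * K₀)⁻¹ + (2 * K₀)⁻¹ = K₀⁻¹ := by rw [mul_inv]; ring
      linarith
    have hder' : ∀ u ∈ Icc t s, K₀ ≤ φ u →
        HasDerivWithinAt φ (derivWithin φ (Ico 0 T) u) (Icc t s) u ∧
          |derivWithin φ (Ico 0 T) u| ≤ η * φ u ^ 2 := fun u hu hKu ↦
      ⟨(hder u (hsT hu)).mono hsT, htime u ⟨ht.1.trans hu.1, hu.2.trans_lt hs.2⟩ x hKu⟩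
    have h := lt_and_inv_le_of_deriv_le_sq (hcont.mono hsT) hK₀ hη.le hder' hφs hsmall
      (left_mem_Icc.2 hs.1.le)
    refine ⟨h.1, h.2.trans ?_⟩
    have : η * (s - t) ≤ η * (T - t) := by gcongr; linarith [hs.2]
    linarith
  refine ⟨(key 1 one_pos).1, ?_⟩
  have hφt : 0 < φ t := hK₀.trans (key 1 one_pos).1
  have hTt : 0 < η * (T - t) := by
    have : 0 < T - t := sub_pos.2 ht.2
    positivity
  have hinv : (φ t)⁻¹ ≤ η * (T - t) :=
    le_of_forall_pos_lt_add fun ε hε ↦ by linarith [(key (ε / 2) (half_pos hε)).2]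
  calc (η * (T - t))⁻¹ ≤ ((φ t)⁻¹)⁻¹ := inv_anti₀ (inv_pos.2 hφt) hinv
    _ = φ t := inv_inv _

/-- **`R(x, t) → +∞` as `t ↑ T` for every `x ∉ Ω`** (Chen–Zhu 2006, §4, p. 24), under the time
gradient estimate near `T` as in `inv_mul_le_scalarCurvature_of_not_mem`: `R(x, t) ≥ (η (T − t))⁻¹`
for `t` close to `T`. [cite: ChenZhu2006, §4, p. 24] -/
theorem IsRicciFlow.tendsto_scalarCurvature_atTop_of_not_mem (hflow : IsRicciFlow g cov (Ico 0 T))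
    {η K₀ tstar : ℝ} (hη : 0 < η) (hK₀ : 0 < K₀) (htstar : tstar ∈ Ico 0 T)
    (htime : ∀ t ∈ Ico tstar T, ∀ x : M, K₀ ≤ (g t).scalarCurvatureWith (cov t) x →
      |derivWithin (fun s ↦ (g s).scalarCurvatureWith (cov s) x) (Ico 0 T) t| ≤
        η * (g t).scalarCurvatureWith (cov t) x ^ 2)
    {x : M} (hx : x ∉ boundedCurvatureSet g cov T) :
    Tendsto (fun t ↦ (g t).scalarCurvatureWith (cov t) x) (𝓝[<] T) atTop := by
  have hT : tstar < T := htstar.2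
  -- the comparison function `(η (T − t))⁻¹ → +∞`
  have hcomp : Tendsto (fun t ↦ (η * (T - t))⁻¹) (𝓝[<] T) atTop := by
    have h1 : Tendsto (fun t ↦ η * (T - t)) (𝓝[<] T) (𝓝[>] 0) := by
      refine tendsto_nhdsWithin_iff.2 ⟨?_, ?_⟩
      · have hc : Continuous fun t : ℝ ↦ η * (T - t) :=
          continuous_const.mul (continuous_const.sub continuous_id)
        have := hc.tendsto T
        simp only [sub_self, mul_zero] at this
        exact this.mono_left nhdsWithin_le_nhds
      · filter_upwards [self_mem_nhdsWithin] with t ht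
        exact mul_pos hη (sub_pos.2 ht)
    exact tendsto_inv_nhdsGT_zero.comp h1
  refine tendsto_atTop_mono' _ ?_ hcomp
  -- eventually `t ∈ [t₁, T)` with `t₁ = max t⋆ (T − (2ηK₀)⁻¹)`
  set t₁ : ℝ := max tstar (T - (2 * η * K₀)⁻¹) with ht₁
  have ht₁T : t₁ < T := max_lt hT (by
    have : 0 < (2 * η * K₀)⁻¹ := by positivity
    linarith)
  have hmem : Ico t₁ T ∈ 𝓝[<] T := Ico_mem_nhdsLT ht₁T
  filter_upwards [hmem] with t ht
  have ht' : t ∈ Ico tstar T := ⟨(le_max_left _ _).trans ht.1, ht.2⟩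
  have hclose : T - t ≤ (2 * η * K₀)⁻¹ := by
    have : T - (2 * η * K₀)⁻¹ ≤ t := (le_max_right _ _).trans ht.1
    linarith
  exact (hflow.inv_mul_le_scalarCurvature_of_not_mem hη hK₀ htstar htime hx ht' hclose).2

/-- **The dichotomy**: under the time gradient estimate near `T`, a point is outside `Ω` if
and only if `R(x, t) → +∞` as `t ↑ T` (`T > 0`). [cite: ChenZhu2006, §4, p. 24] -/
theorem IsRicciFlow.not_mem_boundedCurvatureSet_iff_tendsto (hflow : IsRicciFlow g cov (Ico 0 T))
    {η K₀ tstar : ℝ} (hη : 0 < η) (hK₀ : 0 < K₀) (htstar : tstar ∈ Ico 0 T)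
    (htime : ∀ t ∈ Ico tstar T, ∀ x : M, K₀ ≤ (g t).scalarCurvatureWith (cov t) x →
      |derivWithin (fun s ↦ (g s).scalarCurvatureWith (cov s) x) (Ico 0 T) t| ≤
        η * (g t).scalarCurvatureWith (cov t) x ^ 2)
    (x : M) :
    x ∉ boundedCurvatureSet g cov T ↔
      Tendsto (fun t ↦ (g t).scalarCurvatureWith (cov t) x) (𝓝[<] T) atTop := by
  refine ⟨hflow.tendsto_scalarCurvature_atTop_of_not_mem hη hK₀ htstar htime, fun h hx ↦ ?_⟩
  obtain ⟨K, hK⟩ := hx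
  have hT : 0 < T := htstar.1.trans_lt htstar.2
  have h1 : ∀ᶠ t in 𝓝[<] T, K + 1 ≤ (g t).scalarCurvatureWith (cov t) x :=
    h.eventually (eventually_ge_atTop (K + 1))
  have h2 : ∀ᶠ t in 𝓝[<] T, t ∈ Ico 0 T := Ico_mem_nhdsLT hT
  obtain ⟨t, ht1, ht2⟩ := (h1.and h2).exists
  linarith [hK t ht2]

/-- **A neighbourhood of uniformly bounded curvature around every point of `Ω`** (Chen–Zhu 2006,
§4, p. 24: "`Ω` is open"; the uniform bound is what Shi's local estimates are applied to,
p. 24: "the solution `g_ij(·,t)` has a smooth limit `ḡ_ij(·)` on `Ω`"). Let `(g, cov)` be a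
Ricci flow of Riemannian metrics on `[0, T)`, `T > 0`, on a compact manifold, satisfying both
gradient estimates `|∇R| ≤ η R^{3/2}`, `|∂R/∂t| ≤ η R²` (`η > 0`) at every `(x, t)`,
`t ∈ [t⋆, T)`, with `R(x,t) ≥ K₀ > 0`. Then every `x ∈ Ω` has a neighbourhood `V` with `R ≤ K`
on `V × [0, T)` for one constant `K`. *Proof.* Let `R(x, ·) ≤ K₁` with `K₁ ≥ K₀` and pick
`t₁ ∈ [t⋆, T)` with `T − t₁ ≤ (16 η K₁)⁻¹`. On the `g(t₁)`-ball `V` around `x` of radius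
`(η (4K₁)^{1/2})⁻¹… ` — precisely `(η max(K₀, R(x,t₁))^{1/2})⁻¹` — the spatial estimate gives
`R(·, t₁) ≤ 4K₁` (`le_four_mul_max_of_gradient_estimate`); then forward in time
(`le_inv_sub_of_deriv_le_sq` with `L = 4K₁`) `R(y, t) ≤ ((4K₁)⁻¹ − η (t − t₁))⁻¹ ≤ 8 K₁` on
`[t₁, T)`; before `t₁` the curvature of the whole solution is bounded.
[cite: ChenZhu2006, §4, p. 24] [cite: ChenZhu2006, Thm. 4.1, (4.1) (p. 19)] -/
theorem IsRicciFlow.exists_nhds_forall_scalarCurvature_le [T2Space M]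
    (hflow : IsRicciFlow g cov (Ico 0 T)) (hRiem : ∀ t ∈ Ico 0 T, (g t).IsRiemannian)
    {η K₀ tstar : ℝ} (hη : 0 < η) (hK₀ : 0 < K₀) (htstar : tstar ∈ Ico 0 T)
    (hgrad : ∀ t ∈ Ico tstar T, ∀ x : M, K₀ ≤ (g t).scalarCurvatureWith (cov t) x →
      Real.sqrt ((g t).gradSq (fun z ↦ (g t).scalarCurvatureWith (cov t) z) x) ≤
        η * ((g t).scalarCurvatureWith (cov t) x *
          Real.sqrt ((g t).scalarCurvatureWith (cov t) x)))
    (htime : ∀ t ∈ Ico tstar T, ∀ x : M, K₀ ≤ (g t).scalarCurvatureWith (cov t) x →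
      |derivWithin (fun s ↦ (g s).scalarCurvatureWith (cov s) x) (Ico 0 T) t| ≤
        η * (g t).scalarCurvatureWith (cov t) x ^ 2)
    {x : M} (hx : x ∈ boundedCurvatureSet g cov T) :
    ∃ V ∈ 𝓝 x, ∃ K : ℝ, ∀ y ∈ V, ∀ t ∈ Ico 0 T, (g t).scalarCurvatureWith (cov t) y ≤ K := by
  obtain ⟨K, hK⟩ := hx
  have hT : tstar < T := htstar.2
  -- constants
  set K₁ : ℝ := max K K₀ with hK₁
  have hK₁0 : 0 < K₁ := hK₀.trans_le (le_max_right _ _)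
  have hK₀₁ : K₀ ≤ K₁ := le_max_right _ _
  set t₁ : ℝ := max tstar (T - (16 * η * K₁)⁻¹) with ht₁
  have ht₁T : t₁ < T := max_lt hT (by
    have : 0 < (16 * η * K₁)⁻¹ := by positivity
    linarith)
  have ht₁s : tstar ≤ t₁ := le_max_left _ _
  have ht₁0 : t₁ ∈ Ico 0 T := ⟨htstar.1.trans ht₁s, ht₁T⟩
  have hclose : T - t₁ ≤ (16 * η * K₁)⁻¹ := by
    have : T - (16 * η * K₁)⁻¹ ≤ t₁ := le_max_right _ _
    linarith
  -- the ball at time `t₁`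
  have hg₁ : (g t₁).IsRiemannian := hRiem t₁ ht₁0
  set Rf : M → ℝ := fun z ↦ (g t₁).scalarCurvatureWith (cov t₁) z with hRf
  have h1le : (1 : ℕ∞ω) ≤ ((⊤ : ℕ∞) : ℕ∞ω) := WithTop.coe_le_coe.mpr le_top
  have hRfs : ContMDiff I 𝓘(ℝ, ℝ) 1 Rf :=
    ((hflow.isLeviCivita t₁ ht₁0).contMDiff_trace_ricci).of_le h1le
  set m : ℝ := max K₀ (Rf x) with hm
  have hm0 : 0 < m := hK₀.trans_le (le_max_left _ _)
  have hmK₁ : m ≤ K₁ := max_le hK₀₁ ((hK t₁ ht₁0).trans (le_max_left _ _))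
  set V : Set M := (g t₁).ball x (ENNReal.ofReal (η * Real.sqrt m)⁻¹) with hV
  have hVo : IsOpen V := PseudoRiemannianMetric.isOpen_ball hg₁ x _
  have hxV : x ∈ V := PseudoRiemannianMetric.mem_ball_self x
    (ENNReal.ofReal_pos.2 (by positivity))
  -- at time `t₁`: `R ≤ 4 m ≤ 4 K₁` on `V`
  have hgrad₁ : ∀ z, K₀ ≤ Rf z → Real.sqrt ((g t₁).gradSq Rf z) ≤ η * (Rf z * Real.sqrt (Rf z)) :=
    fun z hz ↦ hgrad t₁ ⟨ht₁s, ht₁T⟩ z hz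
  have hV4 : ∀ y ∈ V, Rf y ≤ 4 * K₁ := fun y hy ↦
    (le_four_mul_max_of_gradient_estimate (g t₁) hg₁ hRfs hK₀ hη hgrad₁ hy).trans
      (mul_le_mul_of_nonneg_left hmK₁ (by norm_num))
  -- bound before `t₁`
  obtain ⟨B₀, hB₀⟩ := hflow.exists_scalarCurvatureWith_le_of_lt ht₁T
  refine ⟨V, hVo.mem_nhds hxV, max B₀ (8 * K₁), fun y hy t ht ↦ ?_⟩
  rcases le_or_gt t t₁ with h | h
  · exact (hB₀ t ⟨ht.1, h⟩ y).trans (le_max_left _ _)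
  -- forward in time from `t₁` at the point `y`
  refine le_trans ?_ (le_max_right _ _)
  set φ : ℝ → ℝ := fun s ↦ (g s).scalarCurvatureWith (cov s) y with hφdef
  have hsub : Icc t₁ t ⊆ Ico 0 T := fun u hu ↦ ⟨ht₁0.1.trans hu.1, hu.2.trans_lt ht.2⟩
  have hcont : ContinuousOn φ (Icc t₁ t) :=
    (hflow.continuousOn_scalarCurvatureWith (uniqueDiffOn_Ico 0 T) y).mono hsub
  have hder' : ∀ u ∈ Icc t₁ t, K₀ ≤ φ u →
      HasDerivWithinAt φ (derivWithin φ (Ico 0 T) u) (Icc t₁ t) u ∧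
        |derivWithin φ (Ico 0 T) u| ≤ η * φ u ^ 2 := fun u hu hKu ↦
    ⟨(hflow.hasDerivWithinAt_scalarCurvatureWith_Ico (hsub hu) y).mono hsub,
      htime u ⟨ht₁s.trans hu.1, hu.2.trans_lt ht.2⟩ y hKu⟩
  have hL : K₀ ≤ 4 * K₁ := by linarith
  have ha : φ t₁ ≤ 4 * K₁ := hV4 y hy
  have hηt : η * (t - t₁) < (16 * K₁)⁻¹ := by
    have h1 : t - t₁ < T - t₁ := by linarith [ht.2]
    have h2 : η * (t - t₁) < η * (T - t₁) := by gcongr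
    have h3 : η * (T - t₁) ≤ η * (16 * η * K₁)⁻¹ := by gcongr
    have h4 : η * (16 * η * K₁)⁻¹ = (16 * K₁)⁻¹ := by
      rw [show 16 * η * K₁ = η * (16 * K₁) by ring, mul_inv, ← mul_assoc,
        mul_inv_cancel₀ hη.ne', one_mul]
    linarith
  have hsmall : η * (t - t₁) < (4 * K₁)⁻¹ := by
    have : (16 * K₁)⁻¹ ≤ (4 * K₁)⁻¹ := inv_anti₀ (by positivity) (by linarith)
    linarith
  have h := le_inv_sub_of_deriv_le_sq hcont hK₀ hη.le hder' hL ha (right_mem_Icc.2 h.le) hsmall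
  refine h.trans ?_
  -- `((4K₁)⁻¹ − η (t − t₁))⁻¹ ≤ ((4K₁)⁻¹ − (16K₁)⁻¹)⁻¹ = 16K₁/3 ≤ 8K₁`
  have hc : (8 * K₁)⁻¹ ≤ (4 * K₁)⁻¹ - η * (t - t₁) := by
    have hu : 0 < (16 * K₁)⁻¹ := by positivity
    have h4' : (4 * K₁)⁻¹ = 4 * (16 * K₁)⁻¹ := by rw [mul_inv, mul_inv]; ring
    have h8' : (8 * K₁)⁻¹ = 2 * (16 * K₁)⁻¹ := by rw [mul_inv, mul_inv]; ring
    rw [h4', h8']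
    linarith
  calc ((4 * K₁)⁻¹ - η * (t - t₁))⁻¹ ≤ ((8 * K₁)⁻¹)⁻¹ := inv_anti₀ (by positivity) hc
    _ = 8 * K₁ := inv_inv _

/-- **`Ω` is open** (Chen–Zhu 2006, §4, p. 24: "The estimates (4.1) imply that `Ω` is open"),
under the two gradient estimates near `T` as in `exists_nhds_forall_scalarCurvature_le`.
[cite: ChenZhu2006, §4, p. 24] -/
theorem IsRicciFlow.isOpen_boundedCurvatureSet [T2Space M]
    (hflow : IsRicciFlow g cov (Ico 0 T)) (hRiem : ∀ t ∈ Ico 0 T, (g t).IsRiemannian)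
    {η K₀ tstar : ℝ} (hη : 0 < η) (hK₀ : 0 < K₀) (htstar : tstar ∈ Ico 0 T)
    (hgrad : ∀ t ∈ Ico tstar T, ∀ x : M, K₀ ≤ (g t).scalarCurvatureWith (cov t) x →
      Real.sqrt ((g t).gradSq (fun z ↦ (g t).scalarCurvatureWith (cov t) z) x) ≤
        η * ((g t).scalarCurvatureWith (cov t) x *
          Real.sqrt ((g t).scalarCurvatureWith (cov t) x)))
    (htime : ∀ t ∈ Ico tstar T, ∀ x : M, K₀ ≤ (g t).scalarCurvatureWith (cov t) x →
      |derivWithin (fun s ↦ (g s).scalarCurvatureWith (cov s) x) (Ico 0 T) t| ≤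
        η * (g t).scalarCurvatureWith (cov t) x ^ 2) :
    IsOpen (boundedCurvatureSet g cov T) := by
  refine isOpen_iff_mem_nhds.2 fun x hx ↦ ?_
  obtain ⟨V, hV, K, hK⟩ :=
    hflow.exists_nhds_forall_scalarCurvature_le hRiem hη hK₀ htstar hgrad htime hx
  exact mem_of_superset hV fun y hy ↦ ⟨K, hK y hy⟩

/-- **Uniformly bounded curvature on compact subsets of `Ω`** (the hypothesis of the local
derivative estimates giving the limit metric `ḡ` on `Ω`, Chen–Zhu 2006, §4, p. 24): under the two
gradient estimates near `T`, for every compact `C ⊆ Ω` there is `K` with `R ≤ K` on `C × [0, T)`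
(finite subcover of the neighbourhoods of `exists_nhds_forall_scalarCurvature_le`).
[cite: ChenZhu2006, §4, p. 24] -/
theorem IsRicciFlow.exists_forall_scalarCurvature_le_of_isCompact [T2Space M]
    (hflow : IsRicciFlow g cov (Ico 0 T)) (hRiem : ∀ t ∈ Ico 0 T, (g t).IsRiemannian)
    {η K₀ tstar : ℝ} (hη : 0 < η) (hK₀ : 0 < K₀) (htstar : tstar ∈ Ico 0 T)
    (hgrad : ∀ t ∈ Ico tstar T, ∀ x : M, K₀ ≤ (g t).scalarCurvatureWith (cov t) x →
      Real.sqrt ((g t).gradSq (fun z ↦ (g t).scalarCurvatureWith (cov t) z) x) ≤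
        η * ((g t).scalarCurvatureWith (cov t) x *
          Real.sqrt ((g t).scalarCurvatureWith (cov t) x)))
    (htime : ∀ t ∈ Ico tstar T, ∀ x : M, K₀ ≤ (g t).scalarCurvatureWith (cov t) x →
      |derivWithin (fun s ↦ (g s).scalarCurvatureWith (cov s) x) (Ico 0 T) t| ≤
        η * (g t).scalarCurvatureWith (cov t) x ^ 2)
    {C : Set M} (hC : IsCompact C) (hCΩ : C ⊆ boundedCurvatureSet g cov T) :
    ∃ K : ℝ, ∀ y ∈ C, ∀ t ∈ Ico 0 T, (g t).scalarCurvatureWith (cov t) y ≤ K := by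
  classical
  -- neighbourhoods with uniform bounds
  have hnb : ∀ x ∈ C, ∃ V ∈ 𝓝 x, ∃ K : ℝ, ∀ y ∈ V, ∀ t ∈ Ico 0 T,
      (g t).scalarCurvatureWith (cov t) y ≤ K := fun x hx ↦
    hflow.exists_nhds_forall_scalarCurvature_le hRiem hη hK₀ htstar hgrad htime (hCΩ hx)
  choose! V hV K hK using hnb
  obtain ⟨F, hFC, hcover⟩ := hC.elim_nhds_subcover V hV
  obtain ⟨Kmax, hKmax⟩ := (F.image K).bddAbove
  refine ⟨Kmax, fun y hy t ht ↦ ?_⟩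
  obtain ⟨x, hxF, hyx⟩ : ∃ x ∈ F, y ∈ V x := by
    simpa only [mem_iUnion, exists_prop] using hcover hy
  exact (hK x (hFC x hxF) y hyx t ht).trans (hKmax (Finset.mem_image_of_mem K hxF))

end Estimates

end Omega


/-! ### Stages satisfying the a priori assumptions (Chen–Zhu 2006, §5, p. 26) -/

section Stage

/-- Local notation: `𝔼 n` is the model Euclidean space `EuclideanSpace ℝ (Fin n)`. -/
local notation "𝔼 " n:arg => EuclideanSpace ℝ (Fin n)

/-- Local notation: smooth pseudo-Riemannian metrics on the tangent bundle of a 4-manifold `M`. -/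
local notation "Metric₄ " M:arg =>
  PseudoRiemannianMetric (𝓡 4) ∞ (EuclideanSpace ℝ (Fin 4)) (TangentSpace (𝓡 4) : M → Type _)

/-- Local notation: covariant derivatives on the tangent bundle of a 4-manifold `M`. -/
local notation "Connection₄ " M:arg =>
  CovariantDerivative (𝓡 4) (EuclideanSpace ℝ (Fin 4)) (TangentSpace (𝓡 4) : M → Type _)

variable {M : Type} [TopologicalSpace M] [T2Space M] [CompactSpace M] [ChartedSpace (𝔼 4) M]
  [IsManifold (𝓡 4) ∞ M] [MeasurableSpace M] [BorelSpace M]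
  {𝔭 : ChenZhuAPrioriParams} {g : ℝ → Metric₄ M} {cov : ℝ → Connection₄ M} {T t₀ : ℝ}

/-- **The gradient estimates of a stage near its singular time.** Let the stage `(g, cov)` on
`[0, T)`, `T > 0`, started at absolute time `t₀ ≥ 0`, satisfy the a priori assumptions with
parameters `𝔭` (`ChenZhuAPriori`), `r` being positive and non-increasing on `[0, ∞)` as in
Chen–Zhu's Thm. 5.6. Then at every `(x, t)` with `t ∈ [T/2, T)` and
`R(x, t) ≥ K₀ := max (r(t₀ + T)⁻², 2/T)` the two gradient estimates of the canonical
neighbourhood assumption hold at `(x, t)` itself: `|∇R| < η R^{3/2}` and `|∂R/∂t| < η R²`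
(`R(x,t) ≥ r(t₀+T)⁻² ≥ r(t₀+t)⁻²` and `R(x,t)⁻¹ ≤ T/2 ≤ t`, so `(x, t)` has a canonical
neighbourhood `B ∋ x`, on which the estimates are part of `HasCanonicalNeighbourhood`).
[cite: ChenZhu2006, §5, p. 26 (canonical neighborhood assumption)] -/
theorem ChenZhuAPriori.gradient_estimates_near (hA : ChenZhuAPriori 𝔭 g cov T t₀) (hT : 0 < T)
    (ht₀ : 0 ≤ t₀) (hrpos : ∀ t ∈ Ici (0 : ℝ), 0 < 𝔭.r t) (hranti : AntitoneOn 𝔭.r (Ici 0))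
    {t : ℝ} (ht : t ∈ Ico (T / 2) T) (x : M)
    (hK : max ((𝔭.r (t₀ + T))⁻¹ ^ 2) (2 / T) ≤ (g t).scalarCurvatureWith (cov t) x) :
    Real.sqrt ((g t).gradSq (fun z ↦ (g t).scalarCurvatureWith (cov t) z) x) <
        𝔭.η * ((g t).scalarCurvatureWith (cov t) x *
          Real.sqrt ((g t).scalarCurvatureWith (cov t) x)) ∧
      |derivWithin (fun s ↦ (g s).scalarCurvatureWith (cov s) x) (Ico 0 T) t| <
        𝔭.η * (g t).scalarCurvatureWith (cov t) x ^ 2 := by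
  have ht' : t ∈ Ico 0 T := ⟨(half_pos hT).le.trans ht.1, ht.2⟩
  have h2T : 0 < 2 / T := by positivity
  have hRpos : 0 < (g t).scalarCurvatureWith (cov t) x := (lt_max_of_lt_right h2T).trans_le hK
  -- the curvature threshold `r(t₀ + t)⁻²`
  have hrT : 0 < 𝔭.r (t₀ + T) := hrpos _ (show (0 : ℝ) ≤ t₀ + T by linarith)
  have hrt : 𝔭.r (t₀ + T) ≤ 𝔭.r (t₀ + t) :=
    hranti (show (0 : ℝ) ≤ t₀ + t by linarith [ht'.1]) (show (0 : ℝ) ≤ t₀ + T by linarith)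
      (by linarith [ht.2])
  have hthr : (𝔭.r (t₀ + t))⁻¹ ^ 2 ≤ (g t).scalarCurvatureWith (cov t) x := by
    refine le_trans ?_ ((le_max_left _ _).trans hK)
    exact pow_le_pow_left₀ (inv_nonneg.2 (hrT.le.trans hrt)) (inv_anti₀ hrT hrt) 2
  -- the window condition `R⁻¹ ≤ t`
  have hwin : ((g t).scalarCurvatureWith (cov t) x)⁻¹ ≤ t := by
    have h1 : ((g t).scalarCurvatureWith (cov t) x)⁻¹ ≤ (2 / T)⁻¹ :=
      inv_anti₀ h2T ((le_max_right _ _).trans hK)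
    rw [inv_div] at h1
    exact h1.trans ht.1
  obtain ⟨B, σ, hσ, -, hball, -, -, -, hgradB⟩ := hA.canonical t ht' x hthr hwin
  have hxB : x ∈ (B : Set M) :=
    hball (PseudoRiemannianMetric.mem_ball_self x (ENNReal.ofReal_pos.2 hσ))
  exact hgradB x hxB

/-- **"The estimates (4.1) imply that `Ω` is open"** (Chen–Zhu 2006, §4, p. 24) for a stage of a
surgical solution: if the Ricci flow of Riemannian metrics `(g, cov)` on `[0, T)`, `T > 0`,
started at absolute time `t₀ ≥ 0`, satisfies the a priori assumptions with parameters `𝔭`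
(`η > 0`, `r` positive and non-increasing on `[0, ∞)`), then `Ω = boundedCurvatureSet g cov T`
is open. [cite: ChenZhu2006, §4, p. 24] [cite: ChenZhu2006, §5, p. 26] -/
theorem ChenZhuAPriori.isOpen_boundedCurvatureSet (hA : ChenZhuAPriori 𝔭 g cov T t₀)
    (hflow : IsRicciFlow g cov (Ico 0 T)) (hRiem : ∀ t ∈ Ico 0 T, (g t).IsRiemannian)
    (hT : 0 < T) (ht₀ : 0 ≤ t₀) (hη : 0 < 𝔭.η) (hrpos : ∀ t ∈ Ici (0 : ℝ), 0 < 𝔭.r t)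
    (hranti : AntitoneOn 𝔭.r (Ici 0)) : IsOpen (boundedCurvatureSet g cov T) := by
  have hts : T / 2 ∈ Ico 0 T := ⟨(half_pos hT).le, half_lt_self hT⟩
  have hK₀ : 0 < max ((𝔭.r (t₀ + T))⁻¹ ^ 2) (2 / T) := lt_max_of_lt_right (by positivity)
  exact hflow.isOpen_boundedCurvatureSet hRiem hη hK₀ hts
    (fun t ht x hx ↦ (hA.gradient_estimates_near hT ht₀ hrpos hranti ht x hx).1.le)
    (fun t ht x hx ↦ (hA.gradient_estimates_near hT ht₀ hrpos hranti ht x hx).2.le)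

/-- **"`R(x,t) → +∞` as `t → T` for each `x ∈ M ∖ Ω`"** (Chen–Zhu 2006, §4, p. 24) for a stage
of a surgical solution satisfying the a priori assumptions (hypotheses as in
`ChenZhuAPriori.isOpen_boundedCurvatureSet`). [cite: ChenZhu2006, §4, p. 24] [cite: ChenZhu2006, §5, p. 26] -/
theorem ChenZhuAPriori.tendsto_scalarCurvature_atTop_of_not_mem (hA : ChenZhuAPriori 𝔭 g cov T t₀)
    (hflow : IsRicciFlow g cov (Ico 0 T)) (hT : 0 < T) (ht₀ : 0 ≤ t₀) (hη : 0 < 𝔭.η)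
    (hrpos : ∀ t ∈ Ici (0 : ℝ), 0 < 𝔭.r t) (hranti : AntitoneOn 𝔭.r (Ici 0)) {x : M}
    (hx : x ∉ boundedCurvatureSet g cov T) :
    Tendsto (fun t ↦ (g t).scalarCurvatureWith (cov t) x) (𝓝[<] T) atTop := by
  have hts : T / 2 ∈ Ico 0 T := ⟨(half_pos hT).le, half_lt_self hT⟩
  have hK₀ : 0 < max ((𝔭.r (t₀ + T))⁻¹ ^ 2) (2 / T) := lt_max_of_lt_right (by positivity)
  exact hflow.tendsto_scalarCurvature_atTop_of_not_mem hη hK₀ hts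
    (fun t ht x hx ↦ (hA.gradient_estimates_near hT ht₀ hrpos hranti ht x hx).2.le) hx

/-- **The blow-up rate off `Ω` for a stage**: under the a priori assumptions, for `x ∉ Ω` and
`t ∈ [T/2, T)` with `T − t ≤ (2 η K₀)⁻¹`, `K₀ = max (r(t₀ + T)⁻², 2/T)`, one has
`R(x, t) ≥ (η (T − t))⁻¹`. [cite: ChenZhu2006, §4, p. 24] [cite: ChenZhu2006, §5, p. 26] -/
theorem ChenZhuAPriori.inv_mul_le_scalarCurvature_of_not_mem (hA : ChenZhuAPriori 𝔭 g cov T t₀)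
    (hflow : IsRicciFlow g cov (Ico 0 T)) (hT : 0 < T) (ht₀ : 0 ≤ t₀) (hη : 0 < 𝔭.η)
    (hrpos : ∀ t ∈ Ici (0 : ℝ), 0 < 𝔭.r t) (hranti : AntitoneOn 𝔭.r (Ici 0)) {x : M}
    (hx : x ∉ boundedCurvatureSet g cov T) {t : ℝ} (ht : t ∈ Ico (T / 2) T)
    (hclose : T - t ≤ (2 * 𝔭.η * max ((𝔭.r (t₀ + T))⁻¹ ^ 2) (2 / T))⁻¹) :
    (𝔭.η * (T - t))⁻¹ ≤ (g t).scalarCurvatureWith (cov t) x := by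
  have hts : T / 2 ∈ Ico 0 T := ⟨(half_pos hT).le, half_lt_self hT⟩
  have hK₀ : 0 < max ((𝔭.r (t₀ + T))⁻¹ ^ 2) (2 / T) := lt_max_of_lt_right (by positivity)
  exact (hflow.inv_mul_le_scalarCurvature_of_not_mem hη hK₀ hts
    (fun t ht x hx ↦ (hA.gradient_estimates_near hT ht₀ hrpos hranti ht x hx).2.le) hx ht
    hclose).2

/-- **Uniformly bounded curvature around the points of `Ω` for a stage** (the input of the local
derivative estimates, Chen–Zhu 2006, §4, p. 24): under the a priori assumptions, every `x ∈ Ω`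
has a neighbourhood `V` with `R ≤ K` on `V × [0, T)`; and on every compact `C ⊆ Ω` there is a
uniform bound. [cite: ChenZhu2006, §4, p. 24] [cite: ChenZhu2006, §5, p. 26] -/
theorem ChenZhuAPriori.exists_nhds_forall_scalarCurvature_le (hA : ChenZhuAPriori 𝔭 g cov T t₀)
    (hflow : IsRicciFlow g cov (Ico 0 T)) (hRiem : ∀ t ∈ Ico 0 T, (g t).IsRiemannian)
    (hT : 0 < T) (ht₀ : 0 ≤ t₀) (hη : 0 < 𝔭.η) (hrpos : ∀ t ∈ Ici (0 : ℝ), 0 < 𝔭.r t)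
    (hranti : AntitoneOn 𝔭.r (Ici 0)) {x : M} (hx : x ∈ boundedCurvatureSet g cov T) :
    ∃ V ∈ 𝓝 x, ∃ K : ℝ, ∀ y ∈ V, ∀ t ∈ Ico 0 T, (g t).scalarCurvatureWith (cov t) y ≤ K := by
  have hts : T / 2 ∈ Ico 0 T := ⟨(half_pos hT).le, half_lt_self hT⟩
  have hK₀ : 0 < max ((𝔭.r (t₀ + T))⁻¹ ^ 2) (2 / T) := lt_max_of_lt_right (by positivity)
  exact hflow.exists_nhds_forall_scalarCurvature_le hRiem hη hK₀ hts
    (fun t ht x hx ↦ (hA.gradient_estimates_near hT ht₀ hrpos hranti ht x hx).1.le)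
    (fun t ht x hx ↦ (hA.gradient_estimates_near hT ht₀ hrpos hranti ht x hx).2.le) hx

/-- Uniform bound on compact subsets of `Ω` for a stage (see
`IsRicciFlow.exists_forall_scalarCurvature_le_of_isCompact`). [cite: ChenZhu2006, §4, p. 24] -/
theorem ChenZhuAPriori.exists_forall_scalarCurvature_le_of_isCompact
    (hA : ChenZhuAPriori 𝔭 g cov T t₀) (hflow : IsRicciFlow g cov (Ico 0 T))
    (hRiem : ∀ t ∈ Ico 0 T, (g t).IsRiemannian) (hT : 0 < T) (ht₀ : 0 ≤ t₀) (hη : 0 < 𝔭.η)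
    (hrpos : ∀ t ∈ Ici (0 : ℝ), 0 < 𝔭.r t) (hranti : AntitoneOn 𝔭.r (Ici 0)) {C : Set M}
    (hC : IsCompact C) (hCΩ : C ⊆ boundedCurvatureSet g cov T) :
    ∃ K : ℝ, ∀ y ∈ C, ∀ t ∈ Ico 0 T, (g t).scalarCurvatureWith (cov t) y ≤ K := by
  have hts : T / 2 ∈ Ico 0 T := ⟨(half_pos hT).le, half_lt_self hT⟩
  have hK₀ : 0 < max ((𝔭.r (t₀ + T))⁻¹ ^ 2) (2 / T) := lt_max_of_lt_right (by positivity)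
  exact hflow.exists_forall_scalarCurvature_le_of_isCompact hRiem hη hK₀ hts
    (fun t ht x hx ↦ (hA.gradient_estimates_near hT ht₀ hrpos hranti ht x hx).1.le)
    (fun t ht x hx ↦ (hA.gradient_estimates_near hT ht₀ hrpos hranti ht x hx).2.le) hC hCΩ

end Stage

end Literature.Geometry.Riemannian

end
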